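import Mathlib
import HarnessLib
import Summits.Ventures.LatticeQCDFlow.Exactness.SphereFamilyLeapfrogHMCErgodic

/-!
# The `n`-step family leapfrog: normal momentum components ride along (positions see only the tangential parts), momenta grow by at most `n|δ|b`, and the `n`-step energy window

HONEST FRAMING: exact (Metropolis-corrected) sampling algorithms for lattice gauge theory;
figures of merit are autocorrelation/cost numbers at stated couplings and volumes; no
continuum-physics claim.

Venture `LatticeQCDFlow` (cell pub-lqcd), topic `Exactness`, FANOUT row 9 (eng-latcore; roadmap Step 4 bookkeeping
toward MULTI-STEP HMC on the `cpn_2d` sphere family, HOME/eng-latcore/HANDOFF.md GEN-19/20).  NEW WORK of the cell over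
the tree (gen-16's `SphereFamilyLeapfrog.lean` / `SphereFamilyLeapfrogHMC.lean` / `SphereFamilyLeapfrogHMCErgodic.lean`:
`famKick`, `famDrift`, `famFlip`, `famLeapfrogPerm`, `famProposal`, `famKinetic`, `norm_snd_ambientDrift`,
`famKinetic_le_of_norm_le`; row 7's `SphereDriftLift.lean`: `ambientDrift`, `tangentialPart`); nothing is cited as a
fact; no number.

THE POINT.  Gen-16's Doeblin argument is for ONE leapfrog step, where the proposed site `i` is one geodesic step of
`(x i, p i + ½δ F x i)` and the ambient momentum enters only through its equatorial part (`map_restrict_axisCylinder`).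
For `n ≥ 2` steps the sites are coupled through the force along the trajectory, but two structural facts survive for
EVERY `n`, every force and every step, and they are what the `n`-step minorisation (roadmap Step 4) consumes:
(1) adding normal components `sᵢ • xᵢ` to the momenta COMMUTES with the kick, the drift and the flip, hence with the
whole `n`-step proposal (`famProposal_famAddNormal`) — so the proposed CONFIGURATION depends on the momenta only through
their tangential parts (`fst_famProposal_famAddNormal`, `fst_famProposal_tangentialPart`), and the Gaussian / Lebesgue
integral over ambient momenta factors through the tangent spaces exactly as in the one-step case; (2) every momentum
component grows by at most `|δ| b` per step (`norm_snd_famLeapfrogPerm_pow_le`), so on the momentum box `‖pᵢ‖ ≤ R` the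
energy after `n` steps exceeds the initial energy by at most `2s + |ι|(R + n|δ|b)²/2` (`famLeapfrog_energy_window_n`) — the
`hwindow` input of `LeapfrogHMCDoeblin.refreshUpdate_involMH_minorised` at every `n`.

* §1 one sphere: `tangentialPart_add_smul`, **`ambientDrift_add_smul`** (the drift of `(x, p + s x)` is the drift of
  `(x, p)` with `s x'` added to the momentum).
* §2 family (no new definitions; "adding normal components" is written out as
  `(z.1, fun i => z.2 i + s i • x i)`): `famKick_famAddNormal`, `famDrift_famAddNormal`, `famFlip_famAddNormal`,
  `famLeapfrogPerm_famAddNormal`, `famLeapfrogPerm_pow_famAddNormal`, **`famProposal_famAddNormal`**,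
  **`fst_famProposal_famAddNormal`**, **`fst_famProposal_tangentialPart`**, **`fst_famProposal_eq_of_tangentialPart_eq`**.
* §3 `norm_snd_famLeapfrogPerm_le`, **`norm_snd_famLeapfrogPerm_pow_le`**, `norm_snd_famProposal_le`,
  **`famLeapfrog_energy_window_n`**.

NOT CLAIMED: the position law / minorisation at `n ≥ 2` (roadmap Steps 1–2 for families, 4, 5), any constant.
-/

noncomputable section

namespace Summit.Ventures.LatticeQCDFlow.Exactness

open MeasureTheory Measure Metric Set Real
open scoped ENNReal InnerProductSpace

/-! ## §1 One sphere: the drift commutes with adding a normal component -/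

section OneSphere

variable {m : Type*} [Fintype m]

/-- Adding a normal component does not change the tangential part. -/
theorem tangentialPart_add_smul (x : sphere (0 : EuclideanSpace ℝ m) 1) (p : EuclideanSpace ℝ m) (s : ℝ) :
    tangentialPart (x, p + s • (x : EuclideanSpace ℝ m)) = tangentialPart (x, p) := by
  simp only [tangentialPart]
  rw [inner_add_right, real_inner_smul_right, real_inner_self_eq_norm_sq, norm_eq_of_mem_sphere x, one_pow,
    mul_one, add_smul]
  abel

/-- **The geodesic drift commutes with adding a normal component**: the drift of `(x, p + s x)` is the drift
`(x', p')` of `(x, p)` with `s x'` added to the momentum (the normal component rides along the body axis). -/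
theorem ambientDrift_add_smul (t : ℝ) (x : sphere (0 : EuclideanSpace ℝ m) 1) (p : EuclideanSpace ℝ m) (s : ℝ) :
    ambientDrift t (x, p + s • (x : EuclideanSpace ℝ m)) =
      ((ambientDrift t (x, p)).1,
        (ambientDrift t (x, p)).2 + s • ((ambientDrift t (x, p)).1 : EuclideanSpace ℝ m)) := by
  have ht := tangentialPart_add_smul x p s
  have hin : ⟪(x : EuclideanSpace ℝ m), p + s • (x : EuclideanSpace ℝ m)⟫_ℝ = ⟪(x : EuclideanSpace ℝ m), p⟫_ℝ + s := by
    rw [inner_add_right, real_inner_smul_right, real_inner_self_eq_norm_sq, norm_eq_of_mem_sphere x, one_pow, mul_one]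
  refine Prod.ext (Subtype.ext ?_) ?_
  · change (geodesicDrift t ((x : EuclideanSpace ℝ m), tangentialPart (x, p + s • (x : EuclideanSpace ℝ m)))).1 =
      (geodesicDrift t ((x : EuclideanSpace ℝ m), tangentialPart (x, p))).1
    rw [ht]
  · change (geodesicDrift t ((x : EuclideanSpace ℝ m), tangentialPart (x, p + s • (x : EuclideanSpace ℝ m)))).2 +
        ⟪(x : EuclideanSpace ℝ m), p + s • (x : EuclideanSpace ℝ m)⟫_ℝ •
          (geodesicDrift t ((x : EuclideanSpace ℝ m), tangentialPart (x, p + s • (x : EuclideanSpace ℝ m)))).1 =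
      ((geodesicDrift t ((x : EuclideanSpace ℝ m), tangentialPart (x, p))).2 +
        ⟪(x : EuclideanSpace ℝ m), p⟫_ℝ • (geodesicDrift t ((x : EuclideanSpace ℝ m), tangentialPart (x, p))).1) +
        s • (geodesicDrift t ((x : EuclideanSpace ℝ m), tangentialPart (x, p))).1
    rw [ht, hin, add_smul, add_assoc]

end OneSphere

/-! ## §2 The family: normal components commute with the whole `n`-step proposal -/

section Family

variable {ι : Type*} [Fintype ι] {k : ι → ℕ}

omit [Fintype ι] in
/-- The coupled kick commutes with adding normal components (the kick depends on the configuration only). -/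
theorem famKick_famAddNormal (F : (Π i, FamS k i) → (Π i, FamE k i)) (δ : ℝ) (s : ι → ℝ)
    (z : (Π i, FamS k i) × (Π i, FamE k i)) :
    famKick F δ (z.1, fun i => z.2 i + s i • (z.1 i : FamE k i)) =
      ((famKick F δ z).1, fun i => (famKick F δ z).2 i + s i • ((famKick F δ z).1 i : FamE k i)) := by
  refine Prod.ext rfl (funext fun i => ?_)
  simp only [famKick, Pi.add_apply, Pi.smul_apply]
  abel

omit [Fintype ι] in
/-- The sitewise drift commutes with adding normal components (`ambientDrift_add_smul` at every index). -/
theorem famDrift_famAddNormal (t : ℝ) (s : ι → ℝ) (z : (Π i, FamS k i) × (Π i, FamE k i)) :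
    famDrift t (z.1, fun i => z.2 i + s i • (z.1 i : FamE k i)) =
      ((famDrift t z).1, fun i => (famDrift t z).2 i + s i • ((famDrift t z).1 i : FamE k i)) := by
  refine Prod.ext (funext fun i => ?_) (funext fun i => ?_)
  · change (ambientDrift t (z.1 i, z.2 i + s i • (z.1 i : FamE k i))).1 = (ambientDrift t (z.1 i, z.2 i)).1
    rw [ambientDrift_add_smul]
  · change (ambientDrift t (z.1 i, z.2 i + s i • (z.1 i : FamE k i))).2 =
      (ambientDrift t (z.1 i, z.2 i)).2 + s i • ((ambientDrift t (z.1 i, z.2 i)).1 : FamE k i)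
    rw [ambientDrift_add_smul]

omit [Fintype ι] in
/-- The flip anti-commutes: `flip (z + s x) = flip z + (−s) x`. -/
theorem famFlip_famAddNormal (s : ι → ℝ) (z : (Π i, FamS k i) × (Π i, FamE k i)) :
    famFlip (z.1, fun i => z.2 i + s i • (z.1 i : FamE k i)) =
      ((famFlip z).1, fun i => (famFlip z).2 i + (-s) i • ((famFlip z).1 i : FamE k i)) := by
  refine Prod.ext rfl (funext fun i => ?_)
  simp only [famFlip, Pi.neg_apply, neg_add, neg_smul]

omit [Fintype ι] in
/-- **One leapfrog step commutes with adding normal components.** -/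
theorem famLeapfrogPerm_famAddNormal (F : (Π i, FamS k i) → (Π i, FamE k i)) (δ : ℝ) (s : ι → ℝ)
    (z : (Π i, FamS k i) × (Π i, FamE k i)) :
    famLeapfrogPerm F δ (z.1, fun i => z.2 i + s i • (z.1 i : FamE k i)) =
      ((famLeapfrogPerm F δ z).1, fun i => (famLeapfrogPerm F δ z).2 i + s i • ((famLeapfrogPerm F δ z).1 i : FamE k i)) := by
  change famKick F (δ / 2) (famDrift δ (famKick F (δ / 2) (z.1, fun i => z.2 i + s i • (z.1 i : FamE k i)))) =
    ((famKick F (δ / 2) (famDrift δ (famKick F (δ / 2) z))).1, fun i => (famKick F (δ / 2) (famDrift δ (famKick F (δ / 2) z))).2 i +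
      s i • ((famKick F (δ / 2) (famDrift δ (famKick F (δ / 2) z))).1 i : FamE k i))
  rw [famKick_famAddNormal, famDrift_famAddNormal, famKick_famAddNormal]

omit [Fintype ι] in
/-- **`n` leapfrog steps commute with adding normal components.** -/
theorem famLeapfrogPerm_pow_famAddNormal (F : (Π i, FamS k i) → (Π i, FamE k i)) (δ : ℝ) (s : ι → ℝ) (n : ℕ)
    (z : (Π i, FamS k i) × (Π i, FamE k i)) :
    (famLeapfrogPerm F δ ^ n) (z.1, fun i => z.2 i + s i • (z.1 i : FamE k i)) =
      (((famLeapfrogPerm F δ ^ n) z).1, fun i => ((famLeapfrogPerm F δ ^ n) z).2 i + s i • (((famLeapfrogPerm F δ ^ n) z).1 i : FamE k i)) := by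
  induction n generalizing z with
  | zero => rfl
  | succ n ih => rw [pow_succ, Equiv.Perm.mul_apply, Equiv.Perm.mul_apply, famLeapfrogPerm_famAddNormal, ih]

omit [Fintype ι] in
/-- **THE `n`-STEP PROPOSAL COMMUTES WITH ADDING NORMAL COMPONENTS** (up to the sign of the flip):
`Ψₙ(z + s x) = Ψₙ(z) + (−s) x` — every force, every step, every `n`. -/
theorem famProposal_famAddNormal (F : (Π i, FamS k i) → (Π i, FamE k i)) (δ : ℝ) (n : ℕ) (s : ι → ℝ)
    (z : (Π i, FamS k i) × (Π i, FamE k i)) :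
    famProposal F δ n (z.1, fun i => z.2 i + s i • (z.1 i : FamE k i)) =
      ((famProposal F δ n z).1, fun i => (famProposal F δ n z).2 i + (-s) i • ((famProposal F δ n z).1 i : FamE k i)) := by
  change famFlip ((famLeapfrogPerm F δ ^ n) (z.1, fun i => z.2 i + s i • (z.1 i : FamE k i))) =
    ((famFlip ((famLeapfrogPerm F δ ^ n) z)).1, fun i => (famFlip ((famLeapfrogPerm F δ ^ n) z)).2 i +
      (-s) i • ((famFlip ((famLeapfrogPerm F δ ^ n) z)).1 i : FamE k i))
  rw [famLeapfrogPerm_pow_famAddNormal, famFlip_famAddNormal]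

omit [Fintype ι] in
/-- **THE PROPOSED CONFIGURATION DEPENDS ON THE MOMENTA ONLY THROUGH THEIR TANGENTIAL PARTS**: adding any
normal components to the initial momenta does not move the proposed configuration. -/
theorem fst_famProposal_famAddNormal (F : (Π i, FamS k i) → (Π i, FamE k i)) (δ : ℝ) (n : ℕ) (s : ι → ℝ)
    (z : (Π i, FamS k i) × (Π i, FamE k i)) :
    (famProposal F δ n (z.1, fun i => z.2 i + s i • (z.1 i : FamE k i))).1 = (famProposal F δ n z).1 := by
  rw [famProposal_famAddNormal]

omit [Fintype ι] in
/-- **The proposed configuration from the TANGENTIAL momenta `pᵢ − ⟪xᵢ, pᵢ⟫ xᵢ` is the proposed configuration.** -/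
theorem fst_famProposal_tangentialPart (F : (Π i, FamS k i) → (Π i, FamE k i)) (δ : ℝ) (n : ℕ)
    (z : (Π i, FamS k i) × (Π i, FamE k i)) :
    (famProposal F δ n (z.1, fun i => tangentialPart (z.1 i, z.2 i))).1 = (famProposal F δ n z).1 := by
  have h : (z.1, fun i => tangentialPart (z.1 i, z.2 i)) =
      (z.1, fun i => z.2 i + (fun j => -⟪(z.1 j : FamE k j), z.2 j⟫_ℝ) i • (z.1 i : FamE k i)) := by
    refine Prod.ext rfl (funext fun i => ?_)
    simp only [tangentialPart, neg_smul, sub_eq_add_neg]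
  rw [h, fst_famProposal_famAddNormal]

omit [Fintype ι] in
/-- **Conversely, the proposed configuration from ANY momenta with the same tangential parts is the same**: if
`pᵢ − ⟪xᵢ,pᵢ⟫xᵢ = p'ᵢ − ⟪xᵢ,p'ᵢ⟫xᵢ` for all `i` then `(Ψₙ(x, p)).1 = (Ψₙ(x, p')).1`. -/
theorem fst_famProposal_eq_of_tangentialPart_eq (F : (Π i, FamS k i) → (Π i, FamE k i)) (δ : ℝ) (n : ℕ)
    (x : Π i, FamS k i) {p p' : Π i, FamE k i} (h : ∀ i, tangentialPart (x i, p i) = tangentialPart (x i, p' i)) :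
    (famProposal F δ n (x, p)).1 = (famProposal F δ n (x, p')).1 := by
  rw [← fst_famProposal_tangentialPart F δ n (x, p), ← fst_famProposal_tangentialPart F δ n (x, p')]
  simp only [h]

/-! ## §3 Momentum growth along the trajectory and the `n`-step energy window -/

variable {F : (Π i, FamS k i) → (Π i, FamE k i)} {δ : ℝ}

omit [Fintype ι] in
/-- **One leapfrog step lengthens each momentum by at most `|δ| b`** (two half kicks of size `½|δ|‖F‖ ≤ ½|δ|b`; the
drift preserves the length, `norm_snd_ambientDrift`). -/
theorem norm_snd_famLeapfrogPerm_le {b : ℝ} (hb : ∀ x i, ‖F x i‖ ≤ b) (δ : ℝ) (z : (Π i, FamS k i) × (Π i, FamE k i))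
    (i : ι) : ‖(famLeapfrogPerm F δ z).2 i‖ ≤ ‖z.2 i‖ + |δ| * b := by
  change ‖((famDrift δ (famKick F (δ / 2) z)).2 + (δ / 2) • F (famDrift δ (famKick F (δ / 2) z)).1) i‖ ≤ _
  rw [Pi.add_apply, Pi.smul_apply]
  have h2 : ‖(famDrift δ (famKick F (δ / 2) z)).2 i‖ = ‖z.2 i + (δ / 2) • F z.1 i‖ := by
    change ‖(ambientDrift δ (z.1 i, z.2 i + (δ / 2) • F z.1 i)).2‖ = _
    exact norm_snd_ambientDrift δ _
  have hhalf : ∀ y : Π i, FamS k i, ‖(δ / 2) • F y i‖ ≤ |δ| / 2 * b := fun y => by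
    rw [norm_smul, Real.norm_eq_abs, abs_div, abs_two]
    exact mul_le_mul_of_nonneg_left (hb y i) (by positivity)
  calc ‖(famDrift δ (famKick F (δ / 2) z)).2 i + (δ / 2) • F (famDrift δ (famKick F (δ / 2) z)).1 i‖
      ≤ ‖(famDrift δ (famKick F (δ / 2) z)).2 i‖ + ‖(δ / 2) • F (famDrift δ (famKick F (δ / 2) z)).1 i‖ :=
        norm_add_le _ _
    _ ≤ (‖z.2 i‖ + |δ| / 2 * b) + |δ| / 2 * b := by
        rw [h2]
        exact add_le_add ((norm_add_le _ _).trans (add_le_add le_rfl (hhalf z.1))) (hhalf _)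
    _ = ‖z.2 i‖ + |δ| * b := by ring

omit [Fintype ι] in
/-- **`n` leapfrog steps lengthen each momentum by at most `n |δ| b`.** -/
theorem norm_snd_famLeapfrogPerm_pow_le {b : ℝ} (hb : ∀ x i, ‖F x i‖ ≤ b) (δ : ℝ) (n : ℕ)
    (z : (Π i, FamS k i) × (Π i, FamE k i)) (i : ι) :
    ‖((famLeapfrogPerm F δ ^ n) z).2 i‖ ≤ ‖z.2 i‖ + n * (|δ| * b) := by
  induction n generalizing z with
  | zero => simp
  | succ n ih =>
    rw [pow_succ', Equiv.Perm.mul_apply, Nat.cast_succ]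
    calc ‖(famLeapfrogPerm F δ ((famLeapfrogPerm F δ ^ n) z)).2 i‖
        ≤ ‖((famLeapfrogPerm F δ ^ n) z).2 i‖ + |δ| * b := norm_snd_famLeapfrogPerm_le hb δ _ i
      _ ≤ ‖z.2 i‖ + n * (|δ| * b) + |δ| * b := by gcongr; exact ih z
      _ = ‖z.2 i‖ + (n + 1) * (|δ| * b) := by ring

omit [Fintype ι] in
/-- **The proposed momentum after `n` steps is at most `n |δ| b` longer than the initial one** (the flip preserves
lengths). -/
theorem norm_snd_famProposal_le {b : ℝ} (hb : ∀ x i, ‖F x i‖ ≤ b) (δ : ℝ) (n : ℕ)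
    (z : (Π i, FamS k i) × (Π i, FamE k i)) (i : ι) :
    ‖(famProposal F δ n z).2 i‖ ≤ ‖z.2 i‖ + n * (|δ| * b) := by
  change ‖(-((famLeapfrogPerm F δ ^ n) z).2) i‖ ≤ _
  rw [Pi.neg_apply, norm_neg]
  exact norm_snd_famLeapfrogPerm_pow_le hb δ n z i

/-- **THE `n`-STEP ENERGY WINDOW**: for momenta in the box `‖pᵢ‖ ≤ R`, a force bounded by `b` and an action bounded
by `s`, `H(Ψₙ(x, p)) ≤ H(x, p) + 2s + |ι|(R + n|δ|b)²/2`. -/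
theorem famLeapfrog_energy_window_n {b : ℝ} (hb : ∀ x i, ‖F x i‖ ≤ b)
    {S : (Π i, FamS k i) → ℝ} {s : ℝ} (hs : ∀ x, |S x| ≤ s) {R : ℝ} (n : ℕ)
    (x : Π i, FamS k i) {p : Π i, FamE k i} (hp : ∀ i, ‖p i‖ ≤ R) :
    (fun z : (Π i, FamS k i) × (Π i, FamE k i) => S z.1 + famKinetic z.2) (famProposal F δ n (x, p)) ≤
      (fun z : (Π i, FamS k i) × (Π i, FamE k i) => S z.1 + famKinetic z.2) (x, p) +
        (2 * s + Fintype.card ι * (R + n * (|δ| * b)) ^ 2 / 2) := by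
  have h1 : S (famProposal F δ n (x, p)).1 ≤ s := (abs_le.1 (hs _)).2
  have h2 : -s ≤ S x := (abs_le.1 (hs x)).1
  have h3 : 0 ≤ famKinetic p := famKinetic_nonneg p
  have h4 : famKinetic (famProposal F δ n (x, p)).2 ≤ Fintype.card ι * (R + n * (|δ| * b)) ^ 2 / 2 :=
    famKinetic_le_of_norm_le fun i =>
      (norm_snd_famProposal_le hb δ n (x, p) i).trans (add_le_add (hp i) le_rfl)
  change S (famProposal F δ n (x, p)).1 + famKinetic (famProposal F δ n (x, p)).2 ≤
    S x + famKinetic p + (2 * s + Fintype.card ι * (R + n * (|δ| * b)) ^ 2 / 2)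
  linarith

end Family

end Summit.Ventures.LatticeQCDFlow.Exactness

end
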